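import Summits.ResolutionOfSingularities.ResolutionOfSingularities.Theorems.FrobeniusLadderFInjectiveMacaulayficationPencilFedder
import Summits.ResolutionOfSingularities.ResolutionOfSingularities.Theorems.FrobeniusLadderFInjectiveMacaulayficationPencilIntegral
import Summits.ResolutionOfSingularities.ResolutionOfSingularities.Theorems.FrobeniusLadderFInjectiveMacaulayficationPencilBlowupLocalCharts
import HarnessLib

/-!
# BED Ω, GLOBAL PATCH (g-b), F4 (c) GLUE, ALGEBRA OF THE PENCIL RINGS OVER A HYPERSURFACE CHART RING `A = k[y]/(g)`: `A[X]/(ūX − v̄) ≅ k[X₀, y]/(g⁺, u⁺X₀ − v⁺)`, its CM clause at every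
# prime from ✓ `CICodimTwoCM`, and the regular-pair bookkeeping in `A`
# (crux `FInjectiveMacaulayfication` stmt-ResolutionOfSingularities-15315, chain w45a; res-L1-w45a-plan-1 BOOKED 2026-08-29T08:08:13Z «F4(c) GLUE»; seat res-L1-w45a-stub-3 g14)

[OURS · L1 W4.5a] Support file (`--supports stmt-ResolutionOfSingularities-15315 --as helper`); theorems only; GENERIC (any field `k`, any `g, u, v ∈ k[y₁..y_n]`); no named fact; NOT a statement of
any manuscript; nothing of the crux is proved. AI-written (AI review is weaker than expert review).

These are the ring-level inputs of ✓p709719 `PencilBlowupLocalCharts.cmCl_stalk_of_pair` when the affine open is a toric chart `Γ(X̃, U_c) ≅ k[y]/(θ_c)` (✓ `MonomialChartSections`):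
* §1 `exists_ringEquiv_pencilQuot_finSucc` — for `Φ : A ≅ k[y]/(g)` with `Φ u = ū₀`, `Φ v = v̄₀`: `A[X]/(uX − v) ≅ k[Y₀..Y_n]/(g⁺, u₀⁺·Y₀ − v₀⁺)` (`q⁺ = rename Fin.succ q`; through Mathlib
  `MvPolynomial.finSuccEquiv`, as in ✓ `PencilIntegral.pencilChart_isPrime`; stated for an abstract `A` — e.g. `A = Γ(X̃, U_c)` — because the type `(k[y]/(g))[X]/…` does not elaborate);
  `prime_rename_succ`, `pderiv_zero_rename_succ`, `not_dvd_pencil_rename_succ`, ★ `cmCl_localization_pencilQuot` — for `g` prime with `g ∤ u₀`, EVERY localization of `A[X]/(uX − v)` satisfies the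
  CM clause (✓ `CICodimTwoCM.cmCl_localization_of_prime_of_not_dvd` + ✓ `PencilFedder.not_dvd_pencil_of_not_dvd`) — exactly the hypotheses `hW`/`hU` of ✓p709719 `cmCl_stalk_of_pair`.
* §2 bookkeeping in the domain `A = k[y]/(g)`: `mk_mem_nonZeroDivisors`, `not_dvd_monomial_of_forall_not_X_dvd`, `not_X_dvd_of_constantCoeff_ne_zero`, ★ `regularPair_of_isPrime`
  (`(v̄, ū)` is a regular pair as soon as `(g, v)` is a prime ideal not containing `u`) and `regularPair_symm` (in a domain, `(u, v)` regular ⇒ `(v, u)` regular).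
[folklore; cite: Matsumura1987, Thm. 17.4; StacksProject, Tag 0BIQ]
-/

set_option linter.dupNamespace false

noncomputable section

open MvPolynomial Polynomial

namespace Summit.ResolutionOfSingularities.ResolutionOfSingularities.Theorems.FInjectiveMacaulayfication.PencilQuotFinSucc

open Summit.ResolutionOfSingularities.ResolutionOfSingularities.Theorems.FInjectiveMacaulayfication
open SliceableCentre

variable (k : Type) [Field k] {n : ℕ}

/-! ## §1 `A[X]/(uX − v) ≅ k[Y₀..Y_n]/(g⁺, u₀⁺Y₀ − v₀⁺)` for `A ≅ k[y]/(g)`, and its CM clause -/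

/-- **`A[X]/(uX − v) ≅ k[Y₀, Y₁, …, Y_n]/(g⁺, u₀⁺·Y₀ − v₀⁺)`** for a ring `A` identified with `k[y]/(g)` by `Φ` (`Φ u = ū₀`, `Φ v = v̄₀`; `q⁺ = rename Fin.succ q`, the pencil variable is `Y₀`).
(The type `(k[y]/(g))[X]/…` itself is avoided: its instances do not elaborate.) [folklore; cite: StacksProject, Tag 0BIQ] -/
theorem exists_ringEquiv_pencilQuot_finSucc {A : Type} [CommRing A] (g : MvPolynomial (Fin n) k) (Φ : A ≃+* (MvPolynomial (Fin n) k ⧸ Ideal.span {g}))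
    (u v : A) (u₀ v₀ : MvPolynomial (Fin n) k) (hu : Φ u = Ideal.Quotient.mk (Ideal.span {g}) u₀) (hv : Φ v = Ideal.Quotient.mk (Ideal.span {g}) v₀) :
    Nonempty ((A[X] ⧸ Ideal.span {Polynomial.C u * Polynomial.X - Polynomial.C v}) ≃+*
      (MvPolynomial (Fin (n + 1)) k ⧸ Ideal.span {rename Fin.succ g, rename Fin.succ u₀ * MvPolynomial.X 0 - rename Fin.succ v₀})) := by
  classical
  set φ : MvPolynomial (Fin n) k →+* A := (Φ.symm : (MvPolynomial (Fin n) k ⧸ Ideal.span {g}) →+* A).comp (Ideal.Quotient.mk (Ideal.span {g})) with hφ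
  have hφsurj : Function.Surjective φ := Φ.symm.surjective.comp Ideal.Quotient.mk_surjective
  have hkerφ : RingHom.ker φ = Ideal.span {g} := by
    ext q
    rw [RingHom.mem_ker, hφ, RingHom.comp_apply, RingHom.coe_coe, map_eq_zero_iff _ Φ.symm.injective, Ideal.Quotient.eq_zero_iff_mem]
  have hφu : φ u₀ = u := by rw [hφ, RingHom.comp_apply, RingHom.coe_coe, ← hu, RingEquiv.symm_apply_apply]
  have hφv : φ v₀ = v := by rw [hφ, RingHom.comp_apply, RingHom.coe_coe, ← hv, RingEquiv.symm_apply_apply]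
  set e := MvPolynomial.finSuccEquiv k n with he
  set ψ : MvPolynomial (Fin (n + 1)) k →+* A[X] := (Polynomial.mapRingHom φ).comp (e : MvPolynomial (Fin (n + 1)) k →+* (MvPolynomial (Fin n) k)[X]) with hψ
  have hψsurj : Function.Surjective ψ := (Polynomial.map_surjective φ hφsurj).comp e.surjective
  have hφG : φ g = 0 := by rw [← RingHom.mem_ker, hkerφ]; exact Ideal.mem_span_singleton_self g
  have hψG : ψ (rename Fin.succ g) = 0 := by
    simp only [hψ, RingHom.coe_comp, Function.comp_apply, RingHom.coe_coe, he, PencilIntegral.finSuccEquiv_rename_succ, Polynomial.coe_mapRingHom, Polynomial.map_C, hφG, map_zero]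
  have hψL : ψ (rename Fin.succ u₀ * MvPolynomial.X 0 - rename Fin.succ v₀) = Polynomial.C u * Polynomial.X - Polynomial.C v := by
    simp only [hψ, RingHom.coe_comp, Function.comp_apply, RingHom.coe_coe, map_sub, map_mul, he, PencilIntegral.finSuccEquiv_rename_succ, MvPolynomial.finSuccEquiv_X_zero,
      Polynomial.coe_mapRingHom, Polynomial.map_C, Polynomial.map_X, hφu, hφv]
  have hker : RingHom.ker ψ = Ideal.span {rename Fin.succ g} := by
    apply le_antisymm
    · intro q hq
      rw [RingHom.mem_ker, hψ, RingHom.comp_apply, ← RingHom.mem_ker, Polynomial.ker_mapRingHom, hkerφ, Ideal.map_span, Set.image_singleton,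
        Ideal.mem_span_singleton'] at hq
      obtain ⟨w, hw⟩ := hq
      rw [Ideal.mem_span_singleton']
      refine ⟨e.symm w, ?_⟩
      apply e.injective
      rw [map_mul, e.apply_symm_apply, he, PencilIntegral.finSuccEquiv_rename_succ]
      exact hw
    · rw [Ideal.span_le, Set.singleton_subset_iff]; exact hψG
  set π := Ideal.Quotient.mk (Ideal.span {Polynomial.C u * Polynomial.X - Polynomial.C v}) with hπ
  have hΨsurj : Function.Surjective (π.comp ψ) := Ideal.Quotient.mk_surjective.comp hψsurj
  have hkerΨ : RingHom.ker (π.comp ψ) = Ideal.span {rename Fin.succ g, rename Fin.succ u₀ * MvPolynomial.X 0 - rename Fin.succ v₀} := by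
    rw [← RingHom.comap_ker, hπ, Ideal.mk_ker, ← hψL, ← Set.image_singleton, ← Ideal.map_span, Ideal.comap_map_of_surjective ψ hψsurj, ← RingHom.ker_eq_comap_bot, hker,
      ← Ideal.span_union, Set.singleton_union, Set.pair_comm]
  exact ⟨(RingHom.quotientKerEquivOfSurjective hΨsurj).symm.trans (Ideal.quotEquivOfEq hkerΨ)⟩

/-- `G` prime in `k[y₁..y_n]` ⇒ `G⁺ = G(Y₁, …, Y_n)` prime in `k[Y₀..Y_n]` (`G⁺ = C G` in `k[y][Y₀]`, Mathlib `Polynomial.prime_C_iff`). [folklore] -/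
theorem prime_rename_succ {G : MvPolynomial (Fin n) k} (hG : Prime G) : Prime (rename Fin.succ G : MvPolynomial (Fin (n + 1)) k) := by
  rw [← MulEquiv.prime_iff (MvPolynomial.finSuccEquiv k n), PencilIntegral.finSuccEquiv_rename_succ]
  exact Polynomial.prime_C_iff.mpr hG

/-- `∂/∂Y₀` kills `q⁺ = rename Fin.succ q`. [bookkeeping] -/
theorem pderiv_zero_rename_succ (q : MvPolynomial (Fin n) k) : pderiv 0 (rename Fin.succ q : MvPolynomial (Fin (n + 1)) k) = 0 := by
  classical
  induction q using MvPolynomial.induction_on with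
  | C c => rw [rename_C, pderiv_C]
  | add p q hp hq => rw [map_add, map_add, hp, hq, add_zero]
  | mul_X p i hp => rw [map_mul, rename_X, Derivation.leibniz, hp, pderiv_X, Pi.single_eq_of_ne (Fin.succ_ne_zero i), smul_zero, smul_zero, add_zero]

/-- `g ∤ u₀` ⇒ `g⁺ ∤ u₀⁺·Y₀ − v₀⁺` (all three free of `Y₀`; ✓ `PencilFedder.not_dvd_pencil_of_not_dvd`). [folklore] -/
theorem not_dvd_pencil_rename_succ (g u₀ v₀ : MvPolynomial (Fin n) k) (hgu : ¬ g ∣ u₀) :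
    ¬ (rename Fin.succ g : MvPolynomial (Fin (n + 1)) k) ∣ rename Fin.succ u₀ * MvPolynomial.X 0 - rename Fin.succ v₀ := by
  refine PencilFedder.not_dvd_pencil_of_not_dvd k 0 _ _ _ (pderiv_zero_rename_succ k g) (pderiv_zero_rename_succ k u₀) (pderiv_zero_rename_succ k v₀) fun h => hgu ?_
  have h' := map_dvd (MvPolynomial.finSuccEquiv k n : MvPolynomial (Fin (n + 1)) k →+* (MvPolynomial (Fin n) k)[X]) h
  rw [RingHom.coe_coe, PencilIntegral.finSuccEquiv_rename_succ, PencilIntegral.finSuccEquiv_rename_succ] at h'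
  have h0 := (Polynomial.C_dvd_iff_dvd_coeff _ _).mp h' 0
  rwa [Polynomial.coeff_C_zero] at h0

/-- ★ **EVERY LOCALIZATION OF `A[X]/(uX − v)` SATISFIES THE CM CLAUSE** when `A ≅ k[y]/(g)` with `g` prime, `u ↦ ū₀`, `v ↦ v̄₀` and `g ∤ u₀` (a codimension-2 complete intersection in `k[Y₀..Y_n]`,
✓ `CICodimTwoCM.cmCl_localization_of_prime_of_not_dvd`). [folklore; cite: Matsumura1987, Thm. 17.4] -/
theorem cmCl_localization_pencilQuot {A : Type} [CommRing A] (g : MvPolynomial (Fin n) k) (Φ : A ≃+* (MvPolynomial (Fin n) k ⧸ Ideal.span {g}))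
    (u v : A) (u₀ v₀ : MvPolynomial (Fin n) k) (hu : Φ u = Ideal.Quotient.mk (Ideal.span {g}) u₀) (hv : Φ v = Ideal.Quotient.mk (Ideal.span {g}) v₀)
    (hg : Prime g) (hgu : ¬ g ∣ u₀) (Q : Ideal (A[X] ⧸ Ideal.span {Polynomial.C u * Polynomial.X - Polynomial.C v})) [Q.IsPrime] :
    CMCl (Localization.AtPrime Q) := by
  obtain ⟨e⟩ := exists_ringEquiv_pencilQuot_finSucc k g Φ u v u₀ v₀ hu hv
  exact PencilBlowupLocalCharts.cmCl_localization_of_ringEquiv e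
    (fun Q' _ => CICodimTwoCM.cmCl_localization_of_prime_of_not_dvd k _ _ (prime_rename_succ k hg) (not_dvd_pencil_rename_succ k g u₀ v₀ hgu) Q') Q

/-! ## §2 Bookkeeping in the domain `A = k[y]/(g)` -/

variable {k}

/-- A class `q̄` with `g ∤ q` is a non-zero-divisor of the domain `k[y]/(g)` (`g` prime). [folklore] -/
theorem mk_mem_nonZeroDivisors {g q : MvPolynomial (Fin n) k} (hg : Prime g) (hq : ¬ g ∣ q) :
    Ideal.Quotient.mk (Ideal.span {g}) q ∈ nonZeroDivisors (MvPolynomial (Fin n) k ⧸ Ideal.span {g}) := by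
  haveI : (Ideal.span {g}).IsPrime := (Ideal.span_singleton_prime hg.ne_zero).mpr hg
  haveI : IsDomain (MvPolynomial (Fin n) k ⧸ Ideal.span {g}) := Ideal.Quotient.isDomain _
  refine mem_nonZeroDivisors_of_ne_zero fun h => hq ?_
  rwa [Ideal.Quotient.eq_zero_iff_mem, Ideal.mem_span_singleton] at h

/-- A polynomial with nonzero constant coefficient is divisible by no variable. [folklore] -/
theorem not_X_dvd_of_constantCoeff_ne_zero {g : MvPolynomial (Fin n) k} (hg0 : constantCoeff g ≠ 0) (i : Fin n) : ¬ (X i ∣ g) := by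
  rintro ⟨q, rfl⟩
  exact hg0 (by simp)

/-- A prime `g` divisible by no variable divides no monomial. [folklore] -/
theorem not_dvd_monomial_of_forall_not_X_dvd {g : MvPolynomial (Fin n) k} (hg : Prime g) (hcop : ∀ i : Fin n, ¬ (X i ∣ g)) (M : Fin n →₀ ℕ) :
    ¬ g ∣ monomial M (1 : k) := by
  classical
  rw [monomial_eq, MvPolynomial.C_1, one_mul, Finsupp.prod_fintype _ _ (fun i => by simp)]
  intro h
  obtain ⟨i, -, hi⟩ := (Prime.dvd_finsetProd_iff hg _).mp h
  have hX : g ∣ X i := hg.dvd_of_dvd_pow hi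
  exact hcop i (hg.irreducible.dvd_symm (MvPolynomial.X_prime (R := k) (i := i)).irreducible hX)

/-- ★ **REGULAR PAIR FROM A PRIME PAIR IDEAL**: if `(g, v)` is a prime ideal of `k[y]` not containing `u`, then `ū` is regular modulo `v̄` in `k[y]/(g)`: `v̄ ∣ r·ū ⇒ v̄ ∣ r`.
[folklore; cite: Matsumura1987, Thm. 17.4] -/
theorem regularPair_of_isPrime {g u v : MvPolynomial (Fin n) k} (hP : (Ideal.span {g, v}).IsPrime) (hu : u ∉ Ideal.span {g, v}) :
    ∀ r : MvPolynomial (Fin n) k ⧸ Ideal.span {g}, Ideal.Quotient.mk (Ideal.span {g}) v ∣ r * Ideal.Quotient.mk (Ideal.span {g}) u →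
      Ideal.Quotient.mk (Ideal.span {g}) v ∣ r := by
  intro r hr
  obtain ⟨r, rfl⟩ := Ideal.Quotient.mk_surjective r
  obtain ⟨s, hs⟩ := hr
  obtain ⟨s, rfl⟩ := Ideal.Quotient.mk_surjective s
  rw [← map_mul, ← map_mul, Ideal.Quotient.eq, Ideal.mem_span_singleton] at hs
  obtain ⟨c, hc⟩ := hs
  -- `r·u ∈ (g, v)`, a prime not containing `u` ⇒ `r ∈ (g, v)` ⇒ `v̄ ∣ r̄`
  have hru : r * u ∈ Ideal.span {g, v} := by
    rw [show r * u = c * g + s * v by linear_combination hc]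
    exact Ideal.add_mem _ (Ideal.mul_mem_left _ _ (Ideal.subset_span (by simp))) (Ideal.mul_mem_left _ _ (Ideal.subset_span (by simp)))
  have hr' : r ∈ Ideal.span {g, v} := (hP.mem_or_mem hru).resolve_right hu
  obtain ⟨a, b, hab⟩ := Ideal.mem_span_pair.mp hr'
  refine ⟨Ideal.Quotient.mk _ b, ?_⟩
  rw [← map_mul, Ideal.Quotient.eq, Ideal.mem_span_singleton]
  exact ⟨a, by linear_combination -hab⟩

/-- In a domain, «`u` regular modulo `v`» implies «`v` regular modulo `u`» (for `v ≠ 0`): `u ∣ r·v ⇒ u ∣ r`. [folklore] -/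
theorem regularPair_symm {A : Type} [CommRing A] [IsDomain A] {u v : A} (hv : v ≠ 0) (h : ∀ r : A, v ∣ r * u → v ∣ r) :
    ∀ r : A, u ∣ r * v → u ∣ r := by
  intro r ⟨s, hs⟩
  -- `r v = u s` ⇒ `v ∣ s u` ⇒ `v ∣ s`, `s = v t` ⇒ `r v = u v t` ⇒ `r = u t`
  obtain ⟨t, rfl⟩ := h s ⟨r, by linear_combination -hs⟩
  exact ⟨t, mul_right_cancel₀ hv (by linear_combination hs)⟩

end Summit.ResolutionOfSingularities.ResolutionOfSingularities.Theorems.FInjectiveMacaulayfication.PencilQuotFinSucc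

end
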